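import Mathlib
import Literature.Barriers.ValiantsHypothesis.AlgebraicNaturalProofs
import Literature.Computability.AlgebraicComplexity.ArithCircuitProofs
import Literature.Computability.AlgebraicComplexity.IMMInVPProofs
import Summits.ValiantsHypothesis.ValiantsHypothesis.Theorems.BarrierLeverSuccinctHittingSetsForVPStubFullSupport

/-!
# Route BarrierLever — item `TorusIsolatedDeterminantsHitByVP` (stmt-ValiantsHypothesis-19449):
# torus isolation — the size-`n³` class hits every torus-isolated determinantal layout

**Setting (FSV18, tree regime `d = n` over `ℂ`).** Coefficient variables `c_m`, `m ∈ degLEMonomials n`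
(`|m| ≤ n`); simple class `SmallCircuits ℂ n b = {f : deg f ≤ n, L(f) ≤ n^b}`. A DETERMINANTAL
LAYOUT of size `r` is a matrix `E : Fin r → Fin r → (degLEMonomials n) ⊕ ℂ` (each entry a
coefficient variable or a constant; NO read-once or size hypothesis); its distinguisher is
`det E ∈ ℂ[c_m]`.

**Definitions.** For a permutation `σ` of `Fin r` (Mathlib's orientation: entries `(σ i, i)`):
* `permWeight E σ = Σ_i wt(E (σ i) i) ∈ ℕ^n`, the EXPONENT-SUM vector (`wt(c_m) = m`, `wt(z) = 0`);
* `permConst E σ = ∏_i const(E (σ i) i)` (`const(c_m) = 1`, `const(z) = z`);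
* `permCoef f₀ E σ = ∏_i coef_{f₀}(E (σ i) i)` (`coef(c_m) = coeff_m f₀`, `coef(z) = 1`).
`E` is ISOLATED AT `f₀` (`IsolatedAt f₀ E`) if some permutation `σ₀` with `permConst σ₀ ≠ 0`,
`permCoef f₀ σ₀ ≠ 0` has an exponent-sum vector shared by no other such permutation; `E` is
TORUS-ISOLATED (`TorusIsolated E`) if this holds ignoring `permCoef` (the case of a full-support
`f₀`).

**Theorem A (torus isolation engine, `exists_torusScale_hits`).** If `E` is isolated at `f₀` then
some torus rescaling `f₀(t₁x₁,…,t_nx_n)`, `t ∈ ℂ^n`, satisfies `det E (coeff(f₀(t·x))) ≠ 0`.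
*Proof.* `det E(coeff f₀(t·x)) = P(t)` for the WEIGHT POLYNOMIAL `P = Σ_σ sign σ · permConst σ ·
permCoef σ · T^{permWeight σ}`, whose coefficient at `T^{permWeight σ₀}` is a single nonzero term.

**Theorem B (`isSuccinctHittingSet_torusIsolated`, `torusIsolatedDeterminants_hit`).** For every
`n ≥ 3`, `SmallCircuits ℂ n 3` is a hitting set for ALL torus-isolated determinantal layouts, of
every size `r` (witness: the torus orbit of `f₀ = (1 + Σ x_i)^n`, full support by
`FullSupport.coeff_linearForm_pow_ne_zero`, `L(f₀(t·x)) ≤ n(n+2) + n ≤ n³`). Equivalently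
(**Cor. C**, `not_torusIsolated_of_vanishes`): a determinantal layout that vanishes on
`coeff(SmallCircuits ℂ n b)`, `b ≥ 3` — in particular every determinantal algebraically natural
proof against `VP` — is TORUS-BALANCED.

**`torusIsolatedDeterminantsHitByVP`** = the signature of item stmt-ValiantsHypothesis-19449
VERBATIM. The Chow side, the certificates / limits of the method and the reductions of items
20152 / 20239 to torus-balanced layouts are in `…TorusIsolatedDeterminantsHitByVPReductions.lean`.

Lean text authored by the cell planner seat `valiant-natproofs-p1` (gen 6, HOME/p1/TorusIsolation-
g6.lean; referee REF-G12 §3 / REF-G13 §4 PASS: independent farm rc 0, axioms standard), ported by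
the prover seat (namespace, split only).

WHAT THIS IS NOT: not a hitting set for torus-BALANCED layouts (Hankel / Nisan / catalecticant
type — the open residue of items 20152 / 20239); nothing on FSV Question 6 / crux stmt-14610 or
`VP` vs `VNP`.

References: [ForbesShpilkaVolk2018] §1.2, Question 6, §8 (read-once determinants left open);
Klivans–Spielman (STOC 2001, Thm. 4) and Agrawal–Saha–Saptharishi–Saxena (2012) for monomial
isolation by torus weights; [Burgisser2000] §2.1 (the size measure).
-/

-- layout Summits/ValiantsHypothesis/ValiantsHypothesis forces the duplicated namespace component
set_option linter.dupNamespace false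

namespace Summit.ValiantsHypothesis.ValiantsHypothesis.Theorems.BarrierLever.TorusIsolation

open MvPolynomial Literature.Barriers.ValiantsHypothesis Literature.Computability.AlgebraicComplexity
open Summit.ValiantsHypothesis.ValiantsHypothesis.Theorems.BarrierLever.SuccinctHittingSetsForVP

noncomputable section
variable {n r : ℕ}

/-! ## 1. Torus characters and torus rescaling -/

/-- The torus character `t^m = ∏ᵢ tᵢ ^ mᵢ`. -/
def tpow (t : Fin n → ℂ) (m : Fin n →₀ ℕ) : ℂ := ∏ i, t i ^ m i

/-- `t^0 = 1`. -/
@[simp] theorem tpow_zero (t : Fin n → ℂ) : tpow t 0 = 1 := by simp [tpow]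

/-- `t^(m+m') = t^m · t^m'`. -/
theorem tpow_add (t : Fin n → ℂ) (m m' : Fin n →₀ ℕ) :
    tpow t (m + m') = tpow t m * tpow t m' := by
  simp [tpow, Finsupp.add_apply, pow_add, Finset.prod_mul_distrib]

/-- `t^(Σ w_i) = ∏ t^(w_i)`. -/
theorem tpow_sum {ι : Type*} (t : Fin n → ℂ) (s : Finset ι) (w : ι → Fin n →₀ ℕ) :
    tpow t (∑ i ∈ s, w i) = ∏ i ∈ s, tpow t (w i) := by
  classical
  induction s using Finset.induction_on with
  | empty => simp
  | insert a s ha ih => rw [Finset.sum_insert ha, Finset.prod_insert ha, tpow_add, ih]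

/-- Torus rescaling `f(t₁ x₁, …, t_n x_n)` (a substitution, so it is cheap: `L ≤ L(f) + n`). -/
def torusScale (t : Fin n → ℂ) (f : MvPolynomial (Fin n) ℂ) : MvPolynomial (Fin n) ℂ :=
  aeval (fun i => C (t i) * X i) f

/-- Torus rescaling of a monomial. -/
theorem torusScale_monomial (t : Fin n → ℂ) (m : Fin n →₀ ℕ) (c : ℂ) :
    torusScale t (monomial m c) = monomial m (c * tpow t m) := by
  rw [monomial_eq, monomial_eq, Finsupp.prod_pow]
  simp only [torusScale, map_mul, map_prod, map_pow, aeval_C, aeval_X, algebraMap_eq, mul_pow,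
    Finset.prod_mul_distrib, tpow]
  ring

/-- `coeff_m f(t·x) = t^m · coeff_m f`. -/
theorem coeff_torusScale (t : Fin n → ℂ) (f : MvPolynomial (Fin n) ℂ) (m : Fin n →₀ ℕ) :
    coeff m (torusScale t f) = coeff m f * tpow t m := by
  classical
  conv_lhs => rw [f.as_sum, torusScale, map_sum]
  have h : ∀ s : Fin n →₀ ℕ, aeval (fun i => C (t i) * X i) (monomial s (coeff s f))
      = monomial s (coeff s f * tpow t s) := fun s => torusScale_monomial t s _
  simp only [h, coeff_sum, coeff_monomial]
  rw [Finset.sum_ite_eq']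
  split_ifs with hm
  · rfl
  · rw [notMem_support_iff.mp hm, zero_mul]

/-- Torus rescaling does not raise the degree. -/
theorem totalDegree_torusScale_le (t : Fin n → ℂ) (f : MvPolynomial (Fin n) ℂ) :
    (torusScale t f).totalDegree ≤ f.totalDegree := by
  apply totalDegree_le_of_support_subset
  intro m hm
  rw [mem_support_iff] at hm ⊢
  rw [coeff_torusScale] at hm
  exact left_ne_zero_of_mul hm

/-- Torus rescaling costs at most `n` extra gates: `L(f(t·x)) ≤ L(f) + n`. -/
theorem complexity_torusScale_le (t : Fin n → ℂ) (f : MvPolynomial (Fin n) ℂ) :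
    complexity (torusScale t f) ≤ complexity f + n := by
  have h1 : ∀ i : Fin n, complexity (C (t i) * X i : MvPolynomial (Fin n) ℂ) ≤ 1 := fun i =>
    calc complexity (C (t i) * X i : MvPolynomial (Fin n) ℂ)
        ≤ complexity (C (t i) : MvPolynomial (Fin n) ℂ) +
            complexity (X i : MvPolynomial (Fin n) ℂ) + 1 := complexity_mul_le_holds _ _
      _ = 1 := by rw [complexity_C_holds, complexity_X_holds]
  calc complexity (torusScale t f)
      ≤ complexity f + ∑ i, complexity (C (t i) * X i : MvPolynomial (Fin n) ℂ) :=
        complexity_aeval_le f _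
    _ ≤ complexity f + ∑ _i : Fin n, 1 := by gcongr with i; exact h1 i
    _ = complexity f + n := by simp

/-! ## 2. Determinantal layouts, permutation weights, isolation -/

/-- A determinantal layout of size `r`: every entry a coefficient variable `c_m` or a constant. -/
abbrev Layout (n r : ℕ) := Matrix (Fin r) (Fin r) ((degLEMonomials n) ⊕ ℂ)

namespace Layout

/-- The distinguisher `det E ∈ ℂ[c_m : m ∈ degLEMonomials n]`. -/
def detPoly (E : Layout n r) : MvPolynomial (degLEMonomials n) ℂ := (E.map (Sum.elim X C)).det

/-- Exponent vector of an entry (`m` for `c_m`, `0` for a constant). -/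
def weight (E : Layout n r) (i j : Fin r) : Fin n →₀ ℕ :=
  Sum.elim (fun m : degLEMonomials n => (m : Fin n →₀ ℕ)) (fun _ => 0) (E i j)

/-- Constant factor of an entry (`1` for a variable). -/
def const (E : Layout n r) (i j : Fin r) : ℂ :=
  Sum.elim (fun _ : degLEMonomials n => (1 : ℂ)) id (E i j)

/-- Coefficient factor of an entry at the base polynomial `f₀` (`1` for a constant). -/
def coef (f₀ : MvPolynomial (Fin n) ℂ) (E : Layout n r) (i j : Fin r) : ℂ :=
  Sum.elim (fun m : degLEMonomials n => coeff (m : Fin n →₀ ℕ) f₀) (fun _ => 1) (E i j)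

/-- Exponent-sum vector of a permutation (entries `(σ i, i)`, Mathlib's `det` orientation). -/
def permWeight (E : Layout n r) (σ : Equiv.Perm (Fin r)) : Fin n →₀ ℕ := ∑ i, E.weight (σ i) i

/-- Product of the constants met by a permutation. -/
def permConst (E : Layout n r) (σ : Equiv.Perm (Fin r)) : ℂ := ∏ i, E.const (σ i) i

/-- Product of the `f₀`-coefficients met by a permutation. -/
def permCoef (f₀ : MvPolynomial (Fin n) ℂ) (E : Layout n r) (σ : Equiv.Perm (Fin r)) : ℂ :=
  ∏ i, E.coef f₀ (σ i) i

/-- `E` is ISOLATED AT `f₀`: among the permutations alive at `f₀` (nonzero constant product and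
nonzero coefficient product) one has an exponent-sum vector shared by no other. -/
def IsolatedAt (f₀ : MvPolynomial (Fin n) ℂ) (E : Layout n r) : Prop :=
  ∃ σ₀ : Equiv.Perm (Fin r), E.permConst σ₀ ≠ 0 ∧ E.permCoef f₀ σ₀ ≠ 0 ∧
    ∀ σ, σ ≠ σ₀ → E.permConst σ ≠ 0 → E.permCoef f₀ σ ≠ 0 → E.permWeight σ ≠ E.permWeight σ₀

/-- `E` is TORUS-ISOLATED: some permutation with nonzero constant product has an exponent-sum
vector shared by no other permutation with nonzero constant product. -/
def TorusIsolated (E : Layout n r) : Prop :=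
  ∃ σ₀ : Equiv.Perm (Fin r), E.permConst σ₀ ≠ 0 ∧
    ∀ σ, σ ≠ σ₀ → E.permConst σ ≠ 0 → E.permWeight σ ≠ E.permWeight σ₀

/-- The WEIGHT POLYNOMIAL of `E` at `f₀` in the torus parameters `T₁, …, T_n`. -/
def weightPoly (f₀ : MvPolynomial (Fin n) ℂ) (E : Layout n r) : MvPolynomial (Fin n) ℂ :=
  ∑ σ : Equiv.Perm (Fin r),
    monomial (E.permWeight σ) (((Equiv.Perm.sign σ : ℤ) : ℂ) * E.permConst σ * E.permCoef f₀ σ)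

/-- At a full-support base point every permutation has nonzero coefficient product. -/
theorem permCoef_ne_zero_of_fullSupport (f₀ : MvPolynomial (Fin n) ℂ)
    (hfull : ∀ m : degLEMonomials n, coeff (m : Fin n →₀ ℕ) f₀ ≠ 0) (E : Layout n r)
    (σ : Equiv.Perm (Fin r)) : E.permCoef f₀ σ ≠ 0 := by
  refine Finset.prod_ne_zero_iff.mpr fun i _ => ?_
  unfold coef
  rcases E (σ i) i with m | z
  · exact hfull m
  · exact one_ne_zero

/-- Torus-isolated layouts are isolated at every full-support base point. -/
theorem isolatedAt_of_torusIsolated (f₀ : MvPolynomial (Fin n) ℂ)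
    (hfull : ∀ m : degLEMonomials n, coeff (m : Fin n →₀ ℕ) f₀ ≠ 0) (E : Layout n r)
    (hE : E.TorusIsolated) : E.IsolatedAt f₀ := by
  obtain ⟨σ₀, hc, hiso⟩ := hE
  exact ⟨σ₀, hc, permCoef_ne_zero_of_fullSupport f₀ hfull E σ₀,
    fun σ hσ hcσ _ => hiso σ hσ hcσ⟩

/-! ## 3. The engine -/

/-- Evaluating the layout distinguisher at a coefficient vector = the determinant of the evaluated
layout. -/
theorem eval_detPoly (v : degLEMonomials n → ℂ) (E : Layout n r) :
    eval v E.detPoly = (E.map (Sum.elim v (id : ℂ → ℂ))).det := by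
  rw [detPoly, RingHom.map_det, RingHom.mapMatrix_apply, Matrix.map_map]
  have hfun : (⇑(eval v) ∘ Sum.elim X ⇑C : (degLEMonomials n) ⊕ ℂ → ℂ) = Sum.elim v id := by
    funext x
    rcases x with m | z <;> simp
  rw [hfun]

/-- The entries of the layout evaluated along the torus orbit of `f₀`. -/
theorem entry_torusScale (t : Fin n → ℂ) (f₀ : MvPolynomial (Fin n) ℂ) (E : Layout n r)
    (i j : Fin r) :
    Sum.elim (coeffVector (degLEMonomials n) (torusScale t f₀)) (id : ℂ → ℂ) (E i j)
      = E.coef f₀ i j * E.const i j * tpow t (E.weight i j) := by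
  unfold coef const weight
  rcases E i j with m | z
  · simp [coeff_torusScale]
  · simp

/-- `det E (coeff f₀(t·x)) = weightPoly(t)`. -/
theorem eval_detPoly_torusScale (t : Fin n → ℂ) (f₀ : MvPolynomial (Fin n) ℂ) (E : Layout n r) :
    eval (coeffVector (degLEMonomials n) (torusScale t f₀)) E.detPoly = eval t (E.weightPoly f₀) := by
  rw [eval_detPoly, Matrix.det_apply', weightPoly, map_sum]
  refine Finset.sum_congr rfl fun σ _ => ?_
  rw [eval_monomial, Finsupp.prod_pow]
  simp only [Matrix.map_apply, entry_torusScale, Finset.prod_mul_distrib]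
  rw [← tpow_sum]
  simp only [permWeight, permConst, permCoef, tpow]
  ring

/-- At an isolated permutation the weight polynomial has a single-term coefficient. -/
theorem coeff_weightPoly_of_isolated (f₀ : MvPolynomial (Fin n) ℂ) (E : Layout n r)
    (σ₀ : Equiv.Perm (Fin r))
    (hiso : ∀ σ, σ ≠ σ₀ → E.permConst σ ≠ 0 → E.permCoef f₀ σ ≠ 0 →
      E.permWeight σ ≠ E.permWeight σ₀) :
    coeff (E.permWeight σ₀) (E.weightPoly f₀)
      = ((Equiv.Perm.sign σ₀ : ℤ) : ℂ) * E.permConst σ₀ * E.permCoef f₀ σ₀ := by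
  classical
  rw [weightPoly, coeff_sum, Finset.sum_eq_single σ₀]
  · simp only [coeff_monomial, if_true]
  · intro σ _ hσ
    rw [coeff_monomial]
    split_ifs with h
    · by_cases hc : E.permConst σ = 0
      · simp [hc]
      · by_cases hp : E.permCoef f₀ σ = 0
        · simp [hp]
        · exact absurd h (hiso σ hσ hc hp)
    · rfl
  · intro h
    exact absurd (Finset.mem_univ σ₀) h

/-- The weight polynomial of a layout isolated at `f₀` is nonzero. -/
theorem weightPoly_ne_zero (f₀ : MvPolynomial (Fin n) ℂ) (E : Layout n r) (hE : E.IsolatedAt f₀) :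
    E.weightPoly f₀ ≠ 0 := by
  obtain ⟨σ₀, hc, hp, hiso⟩ := hE
  intro h
  have key := coeff_weightPoly_of_isolated f₀ E σ₀ hiso
  rw [h, coeff_zero] at key
  have hsign : ((Equiv.Perm.sign σ₀ : ℤ) : ℂ) ≠ 0 := by
    exact_mod_cast (Equiv.Perm.sign σ₀).ne_zero
  exact (mul_ne_zero (mul_ne_zero hsign hc) hp) key.symm

/-- A nonzero polynomial over `ℂ` has a non-root. -/
theorem exists_eval_ne_zero {p : MvPolynomial (Fin n) ℂ} (hp : p ≠ 0) :
    ∃ t : Fin n → ℂ, eval t p ≠ 0 := by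
  by_contra h
  push Not at h
  exact hp (MvPolynomial.funext fun x => by rw [h x, map_zero])

/-- **Theorem A (torus isolation engine).** If the layout `E` is isolated at `f₀`, some torus
rescaling of `f₀` is a non-root of `det E`. -/
theorem exists_torusScale_hits (f₀ : MvPolynomial (Fin n) ℂ) (E : Layout n r)
    (hE : E.IsolatedAt f₀) :
    ∃ t : Fin n → ℂ, eval (coeffVector (degLEMonomials n) (torusScale t f₀)) E.detPoly ≠ 0 := by
  obtain ⟨t, ht⟩ := exists_eval_ne_zero (weightPoly_ne_zero f₀ E hE)
  exact ⟨t, by rwa [eval_detPoly_torusScale]⟩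

end Layout

/-! ## 4. The size-`n³` witness family: the torus orbit of `(1 + Σ xᵢ)^n` -/

/-- `f₀ = (1 + x₁ + ⋯ + x_n)^n` (full support, `FullSupport.coeff_linearForm_pow_ne_zero`). -/
def linPow (n : ℕ) : MvPolynomial (Fin n) ℂ := (1 + ∑ i : Fin n, X i) ^ n

/-- `(1 + Σ xᵢ)^n` has full support on `degLEMonomials n`. -/
theorem linPow_fullSupport (m : degLEMonomials n) : coeff (m : Fin n →₀ ℕ) (linPow n) ≠ 0 :=
  FullSupport.coeff_linearForm_pow_ne_zero n (m : Fin n →₀ ℕ) m.2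

/-- `L((1 + Σ xᵢ)^n) ≤ n(n+2)`. -/
theorem complexity_linPow_le : complexity (linPow n) ≤ n * (n + 2) :=
  (FullSupport.complexity_pow_le _ _).trans
    (Nat.mul_le_mul_left n (Nat.add_le_add_right FullSupport.complexity_linearForm_le 1))

/-- Every torus rescaling of `f₀` lies in `SmallCircuits ℂ n 3` (`n ≥ 3`):
`deg ≤ n`, `L ≤ n(n+2) + n ≤ n³`. -/
theorem torusScale_linPow_mem (hn : 3 ≤ n) (t : Fin n → ℂ) :
    torusScale t (linPow n) ∈ SmallCircuits ℂ n 3 := by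
  refine ⟨(totalDegree_torusScale_le t _).trans (FullSupport.totalDegree_linearForm_pow_le n), ?_⟩
  calc complexity (torusScale t (linPow n))
      ≤ complexity (linPow n) + n := complexity_torusScale_le t _
    _ ≤ n * (n + 2) + n := by gcongr; exact complexity_linPow_le
    _ ≤ n ^ 3 := by
        have h2 : 3 * (n * n) ≤ n * (n * n) := Nat.mul_le_mul_right (n * n) hn
        have h1 : 3 * n ≤ n * n := Nat.mul_le_mul_right n hn
        calc n * (n + 2) + n = n * n + 3 * n := by ring
          _ ≤ 3 * (n * n) := by omega
          _ ≤ n * (n * n) := h2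
          _ = n ^ 3 := by ring

/-- The torus orbit of `f₀` is a family of Chow points: `f₀(t·x) = ∏_{k<n} (1 + Σ tᵢ xᵢ)`. -/
theorem torusScale_linPow_eq_prod (t : Fin n → ℂ) :
    torusScale t (linPow n) = ∏ _k : Fin n, (1 + ∑ i : Fin n, C (t i) * X i) := by
  rw [Finset.prod_const, Finset.card_univ, Fintype.card_fin]
  simp [torusScale, linPow, map_pow, map_add, map_sum]

/-! ## 5. Headline statements -/

/-- The class of torus-isolated determinantal distinguishers (every size `r`, constants allowed,
no read-once hypothesis). -/
def TorusIsolatedDeterminants (n : ℕ) : Set (MvPolynomial (degLEMonomials n) ℂ) :=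
  {D | ∃ (r : ℕ) (E : Layout n r), E.TorusIsolated ∧ D = E.detPoly}

/-- **Theorem B.** For `n ≥ 3`, `SmallCircuits ℂ n 3` hits every torus-isolated determinantal
layout. -/
theorem isSuccinctHittingSet_torusIsolated (hn : 3 ≤ n) :
    IsSuccinctHittingSet (degLEMonomials n) (SmallCircuits ℂ n 3) (TorusIsolatedDeterminants n) := by
  rintro D ⟨r, E, hE, rfl⟩ _
  obtain ⟨t, ht⟩ := Layout.exists_torusScale_hits (linPow n) E
    (Layout.isolatedAt_of_torusIsolated _ linPow_fullSupport E hE)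
  exact ⟨_, torusScale_linPow_mem hn t, ht⟩

/-- Theorem B in the eventual shape of the route items (`∀ a ∃ b n₀ ∀ n ≥ n₀`; here `b = n₀ = 3`
uniformly in `a`, the class having no size bound at all). -/
theorem torusIsolatedDeterminants_hit :
    ∀ a : ℕ, ∃ b n₀ : ℕ, ∀ n : ℕ, n₀ ≤ n →
      IsSuccinctHittingSet (degLEMonomials n) (SmallCircuits ℂ n b) (TorusIsolatedDeterminants n) :=
  fun _ => ⟨3, 3, fun _ hn => isSuccinctHittingSet_torusIsolated hn⟩

/-- **Cor. C (necessary condition for determinantal natural proofs).** A layout whose determinant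
vanishes on `coeff(SmallCircuits ℂ n b)`, `b ≥ 3`, `n ≥ 3`, is torus-balanced. -/
theorem not_torusIsolated_of_vanishes (hn : 3 ≤ n) {b : ℕ} (hb : 3 ≤ b) (E : Layout n r)
    (hvan : ∀ f ∈ SmallCircuits ℂ n b, eval (coeffVector (degLEMonomials n) f) E.detPoly = 0) :
    ¬ E.TorusIsolated := fun hE => by
  obtain ⟨t, ht⟩ := Layout.exists_torusScale_hits (linPow n) E
    (Layout.isolatedAt_of_torusIsolated _ linPow_fullSupport E hE)
  exact ht (hvan _ (smallCircuits_mono ℂ hb (by omega) (torusScale_linPow_mem hn t)))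

/-- Cor. C for FSV's `IsNaturalProof`: a determinantal algebraically natural proof against
`SmallCircuits ℂ n b` (`b, n ≥ 3`) is never torus-isolated. -/
theorem not_torusIsolated_of_isNaturalProof (hn : 3 ≤ n) {b : ℕ} (hb : 3 ≤ b) (E : Layout n r)
    {𝒟 : Set (MvPolynomial (degLEMonomials n) ℂ)}
    (h : IsNaturalProof (degLEMonomials n) (SmallCircuits ℂ n b) 𝒟 E.detPoly) :
    ¬ E.TorusIsolated :=
  not_torusIsolated_of_vanishes hn hb E h.2.2

/-- The sharper engine form of Cor. C: vanishing on the torus orbit of ANY `f₀ ∈ 𝒞` forces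
non-isolation at `f₀` (use with structured supports, e.g. multilinear `f₀`). -/
theorem not_isolatedAt_of_vanishes (f₀ : MvPolynomial (Fin n) ℂ) (E : Layout n r)
    (hvan : ∀ t : Fin n → ℂ, eval (coeffVector (degLEMonomials n) (torusScale t f₀)) E.detPoly = 0) :
    ¬ E.IsolatedAt f₀ := fun hE => by
  obtain ⟨t, ht⟩ := Layout.exists_torusScale_hits f₀ E hE
  exact ht (hvan t)

/-- **General witness form.** Any base point `f₀` of degree `≤ n` and size `≤ n^b - n` whose
support isolates a permutation of `E` yields a hit inside `SmallCircuits ℂ n b` (use with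
STRUCTURED supports: the permutations through monomials outside `supp f₀` are dead, so a
torus-balanced layout may still be isolated at a sparse-support `f₀`). -/
theorem hits_of_isolatedAt {b : ℕ} (f₀ : MvPolynomial (Fin n) ℂ) (hdeg : f₀.totalDegree ≤ n)
    (hsize : complexity f₀ + n ≤ n ^ b) (E : Layout n r) (hE : E.IsolatedAt f₀) :
    ∃ f ∈ SmallCircuits ℂ n b, eval (coeffVector (degLEMonomials n) f) E.detPoly ≠ 0 := by
  obtain ⟨t, ht⟩ := Layout.exists_torusScale_hits f₀ E hE
  exact ⟨torusScale t f₀, ⟨(totalDegree_torusScale_le t f₀).trans hdeg,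
    (complexity_torusScale_le t f₀).trans hsize⟩, ht⟩

/-! ## 6. The ledger item -/

/-- **Item `TorusIsolatedDeterminantsHitByVP` (stmt-ValiantsHypothesis-19449), signature verbatim.**
For every `n ≥ 3`, `SmallCircuits ℂ n 3` is a hitting set for every torus-isolated determinantal
layout (the isolation condition inlined over built declarations; it is `Layout.TorusIsolated E` by
`Iff.rfl`). Proof: `isSuccinctHittingSet_torusIsolated`. -/
theorem torusIsolatedDeterminantsHitByVP :
    ∀ n : ℕ, 3 ≤ n → Literature.Barriers.ValiantsHypothesis.IsSuccinctHittingSet (Literature.Barriers.ValiantsHypothesis.degLEMonomials n) (Literature.Barriers.ValiantsHypothesis.SmallCircuits ℂ n 3) {D | ∃ (r : ℕ) (E : Matrix (Fin r) (Fin r) (↥(Literature.Barriers.ValiantsHypothesis.degLEMonomials n) ⊕ ℂ)), (∃ σ₀ : Equiv.Perm (Fin r), (∏ i, Sum.elim (fun _ => (1 : ℂ)) id (E (σ₀ i) i)) ≠ 0 ∧ ∀ σ : Equiv.Perm (Fin r), σ ≠ σ₀ → (∏ i, Sum.elim (fun _ => (1 : ℂ)) id (E (σ i) i)) ≠ 0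 → (∑ i, Sum.elim (fun m : ↥(Literature.Barriers.ValiantsHypothesis.degLEMonomials n) => (m : Fin n →₀ ℕ)) (fun _ => (0 : Fin n →₀ ℕ)) (E (σ i) i)) ≠ (∑ i, Sum.elim (fun m : ↥(Literature.Barriers.ValiantsHypothesis.degLEMonomials n) => (m : Fin n →₀ ℕ)) (fun _ => (0 : Fin n →₀ ℕ)) (E (σ₀ i) i))) ∧ D = (E.map (Sum.elim MvPolynomial.X MvPolynomial.C)).det} := by
  intro n hn D hD hD0
  obtain ⟨r, E, hiso, rfl⟩ := hD
  exact isSuccinctHittingSet_torusIsolated hn _ ⟨r, E, hiso, rfl⟩ hD0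

end

end Summit.ValiantsHypothesis.ValiantsHypothesis.Theorems.BarrierLever.TorusIsolation
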